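import Summits.MatrixMultiplication.MatrixMultiplication.Theses.FidelityWitnesses
import Literature.Computability.AlgebraicComplexity.SmallFormatRank
import Literature.Computability.AlgebraicComplexity.MatMulRankLowerBoundsBlaserProofs

/-!
# Disproof of `SevenEighthsLaw` — findings (cdisprove seat, crux stmt-MatrixMultiplication-4959)

Crux (route FidelityWitnesses, rank 4): `∀ S : P2 → P2 → P2 → ℂ, tensorRank S ≤ 6 →
‖Σ S·⟨2,2,2⟩‖² ≤ 7 · Σ ‖S‖²`, i.e. `M(2,6) = sup_{R(S) ≤ 6} |⟨S,T⟩|²/‖S‖² ≤ 7` (`T = ⟨2,2,2⟩`, `‖T‖² = 8`).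
Equivalently: `dist(T, σ₆)² ≥ 1` — no border-rank-6 tensor is closer to `T` than `T` minus one of
its eight standard terms.

Status: NOT refuted (cycles 1–3). Numerically `M(2,6) = 7.000000` in 1030 + 352 descent runs, attained.
CYCLE 3 (refuter-cdisprove-…-4959-g3-0, 2026-08-16): § (h) LOAD-BEARING ANALYSIS OF THE LEAD'S HARD STUB
`stub_capHardRegime` (picked line singlet-fraction-transfer): product-spannedness dropped ⇒ FALSE by the rational
orthonormal frame `wFrame ⊇ W` (hard regime, `cap = 8`; kernel-checked below and filed for `Negative/CapWithoutProducts`),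
the other hypotheses graded, the three "provable now" stubs confirmed true on paper; § (i) KY-FAN PROFILE of product
6-planes against `W` (new E-picture optimiser, analytic gradient): `sup λ₄ = 3/4` (the one-witness "fourth-angle law"
`λ₄ ≤ 1/2` is FALSE — exact isotropic `S₃`/3-4-5 plane with all four `cos² = 3/4`, `cap = 6`), `sup(λ₃+λ₄) = 3/2`
(TWO-ANGLE LAW, numerically true and sharp on two strata, implies the crux — the natural sharper target),
`sup(λ₂+λ₃+λ₄) = 5/2` and `sup Σλ = 7/2` both attained only at the crux maximisers (0/210 E-picture flows above).
Batched kit job (LM-CP random/real, ℤ₃/ℤ₂-symmetric ansätze, desingularised polynomial factors, order-1 border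
families with honest re-evaluation, clamped-seventh-term fits, two-term pencils, E-picture) queued as kit j013699
(results attach to the item as compute evidence); § (j) border-strata census in the E-picture (19 jet strata + 10 exact
syzygy strata, nothing above 3.5) and two more candidate laws graded (column-pair law FALSE ≥ 1.6025; grid frames ≤ ½).
CYCLE 2 (refuter-cdisprove-…-4959-g2-0, 2026-08-16): § (f) the second variation at `S₀ = T − E` is
`≤ 0` on EVERY honest chart `τ·D₀` of `S₀` (the whole non-compact de Groote family, incl. its stretched
ends), with an exact diagonal/AM–GM structure and null space = the `G_T`-orbit tangents — the
"indefinite Hessian at ⟨2,2,2⟩ − e" kill route of the item's why-it-might-fail is closed on all charts,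
not only on the Winograd/Strassen chart of cycle 1; § (b'') the border side is tangential too:
`7‖S‖² − ⟨S,T⟩² = 6(m−k)² + 28` on the two-parameter Bini-plus-honest family (`ring`); § (g) ISOTOPE
SENSITIVITY: the same bound for `T₋₁ = T − 2E` (same support/weights/norm) is FALSE — kernel-checked
integer witness, ratio `7.0386` (sup `≥ 7.2057`) — and the tight set `{χ : M(T_χ) = 7}` of the pencil is a
convex region `⊇ [−0.9, 1]` meeting the unit circle only at `χ = 1` (`M(e^{iθ}) ≈ 7 + 0.016 θ²`), `χ = 1`
lying on the boundary of the a-priori region `{|6+χ| ≤ 7}`; § (e'') new numerics: Kempf–Ness-balanced ALS (free `G_T`-torus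
rebalancing every sweep; 192 random + 160 stretched-chart/Bini-seeded restarts) — all `≤ 7.000000000000`.
LANDED for import: (cycle 3) p84809 ACCEPTED `…Theorems.SevenEighthsLaw.Negative.CapWithoutProducts` —
`sevenEighthsLaw_capHardRegime_false_without_productSpan`, `sevenEighthsLaw_cap_eight_in_hard_regime`, helpers
`SevenEighthsLawNeg.wFrame/_orthonormal/cap_wFrame/finrank_span_mv_wFrame` (§ (h)); (cycle 2) p77768 ACCEPTED `…Theorems.SevenEighthsLaw.Negative.IsotopeSensitivity` —
`sevenEighthsLaw_biniS2_deficit` / `_biniS2_below` (§ (b'')) and `sevenEighthsLaw_isotopeNegOne_false` (§ (g));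
(cycle 1) p75228 ACCEPTED `Summits.MatrixMultiplication.MatrixMultiplication.Theorems.
SevenEighthsLaw.Negative.SharpConstants` — `sevenEighthsLaw_not_of_int` / `_not_of_dist_lt_one`
(kill switches), `sevenEighthsLaw_dist_ge_one`, `_false_without_rank_bound`, `_false_with_rank_seven`,
`_attained`, `_biniFamily`, `_tight`, `_not_strengthened` (same proofs as below, namespace
`…Theorems`, helpers under `…Theorems.SevenEighthsLawNeg`).
What is here (all `decide`/kernel-checked over `ℤ`, transported to `ℂ`):
* § Transfer — integer witnesses suffice: `violates_of_int` turns `7·normSqZ Sz < (overlapZ Sz)²`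
  plus an integer 6-triad decomposition into a counterexample to the crux (`tensorRank_map_le`).
  Any kill found numerically is landed through this lemma (homogeneity ⇒ integer/Gaussian data).
* § (a) Load-bearing — the rank hypothesis is all there is: `S = T` gives `64 > 56`
  (`false_without_rank_bound`), and rank `≤ 7` does not suffice (Strassen, `false_with_rank_seven`):
  any proof must use `R(S) ≤ 6` versus `7` sharply.
* § (b') ATTAINED — `R(T − E) = 6` honestly (`sixS_eq`: Strassen's algorithm transported so that
  its product `M₆` is the standard term `a₂₂b₂₂c₂₂`; the other six products sum to `T − E`, checked by
  `decide`), so `M(2,6) ≥ 7` is a MAXIMUM over honest rank-6 tensors (`attained`), and every point of the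
  orbit `T − E_xyz` (`E_xyz = |x⟩⟨y|⊗|y⟩⟨z|⊗|z⟩⟨x|`, `(P¹)³`, 6 real dims) is an honest maximiser.
* § (b) Tightness — the Bini-plus-one family `biniS m = m·(T − E) + C₂` (six integer triads,
  `E = a₂₂⊗b₂₂⊗c₂₂`, `C₂ ⊥ T`, `‖C₂‖² = 4`): `overlapZ = 7m`, `normSqZ = 7m² + 4`, ratio
  `7 − 28/(7m² + 4) ↑ 7`.  Hence the constant `7` cannot be lowered (`tight`), and the natural
  strengthening "`≤ (7 − 1/100)·‖S‖²`" is false (`not_strengthened`).  (By § (b') the value `7`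
  is even attained; the family shows in addition that honest rank-6 tensors approach `T − E` from
  strictly below along the Bini direction, and the circle
  `Bini + a₂₂ ⊗ (cos θ b₂₁ + sin θ b₂₂) ⊗ (cos θ c₁₂ + sin θ c₂₂)` lies inside the orbit `T − E_xyz`.)
* § (c) Why it resists (so far) — first/second variation at `P = T − E`: along every curve
  `P + sQ₁ + s²Q₂ ⊂ σ₆`, ratio `= 7 + 2 Re(s·Q₁[E]) + (2 Re(s² Q₂[E]) − |s|²‖Q₁^{⊥P}‖²) + O(s³)`;
  inside the order-1 Bini chart every first-order direction has `Q₁[E] = 0` (no leading factor of the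
  scheme touches index `22` in two slots), so `P` is critical there; the Bini family above realises
  `Q₁ = C₂ ⊥ P`, `Q₂ = 0`: ratio `7 − 4s²`, approach from BELOW.
  SECOND ORDER on the honest chart (num/local/hessian.py, exact integer data `sixW/U/V`): the E-row of
  the `64×72` Jacobian `dΦ` vanishes identically (criticality on the Strassen-6 chart; `rank dΦ = 57`,
  Gram of `(I − P̂P̂ᵀ)dΦ` has inertia `(56,0,16)`), `Q₂[E] = ½ d²Φ(δ,δ)[E] = δZ₃δX₃ + δZ₂δY₂ − δX₆δY₆`
  (e-components; only products 2, 3, 6 carry an index-`22` factor), and the real quadratic form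
  `δ ↦ 2 Re Q₂[E] − ‖Q₁^{⊥P}‖²` on `ℂ⁷² = ℝ¹⁴⁴` splits as `(2B − G) ⊕ (−2B − G)` with BOTH blocks
  negative semidefinite: max eigenvalue `0` (to `1e−5`), inertia `(0, 53, 19)` each.  So `S₀` is a
  second-order local maximiser along every honest-chart curve (19 flat directions = 15 gauge + the
  maximiser orbit), and the one catalogued invisible direction (Bini border line) descends (`−4`).
* § (d) Diagonal pencil (DEAD as a kill) — every full-support reweighting of `T` is torus-equivalent
  to `T_u = T + (u−1)·E` (`u = ∏ s_{ijk}^{(−1)^{i+j+k}}`, `T_u ≅ T_{1/u}`); a root `u₀ ∉ {0,∞}` of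
  `[T_u ∈ σ₆]` with `|log u₀| < 2√2` would give ratio `≈ 8 − |log u₀|²/8 > 7`.  Scanned (pure-python
  complex ALS, rank 6, 3000 sweeps × 2 restarts per point; folder num/local/uscan_*.txt): real
  `u ∈ [−3,3]` step `0.1`, circles `|u| = 1` (every 10°), `|u| ∈ {1/4, 1/2, 2}` (every 20°):
  `dist²(T_u, σ₆) = min(|u|², 1)` to 4 digits everywhere EXCEPT a second branch `≈ 0.79–0.83` for
  `Re u ≲ −0.35` (and `0.79 ↗ 1.00` along `|u| = 1` from `180°` to `0°`); no root besides `u = 0`.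
  Continuing the second branch to `u = 1` (num/local/cont*.txt, arc_*.txt) lands on `T − E_xyz`
  (ratio `7.000000`, `T − S` rank one): it is not a new contact.
* § (e) Global numerics at `T` (all local, pure python; kit jobs j010041 = LM + order-1/2/3 border
  schemes + Strassen-drop seeds, j010042 = LM u-scan, queued at the time of writing):
  - complex ALS rank 6, 3000 sweeps: 780 random restarts + 60 restarts from perturbed maximisers
    (σ ∈ {0.01,…,1}) — ALL end at `‖T − S‖² = 1.0000`, ratio `7.000000`; not a single other critical
    value appears (num/local/camp_*.txt).  Calibration with the same code: rank 3 → `8 − 3.005813`,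
    rank 4 → `8 − 4.414214 (= 3+√2)`, rank 5 → `2.000` (Bini, border), rank 7 → `0` — the planner's
    fidelity curve `M(2,r) = 1, 2, 3.0058, 3+√2, 6, 7, 8` is reproduced.
  - feasibility instead of distance: alternating projections between the second-order cone
    `K_c = {Re⟨S,T̂⟩ ≥ √(c/8)‖S‖}` and rank-6 tensors, `c ∈ {7.02, 7.1, 7.3, 7.6}`, 4 restarts × 3000
    rounds each: infeasible, `dist(R, K_c) → 0.015, 0.055, 0.173, 0.473`, best ratio `7.0000` (cone_*.txt).
  - perturbation/escape tests at the corner `P`, the symmetric maximiser `x=y=z=(1,1)/√2` and two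
    generic `E_xyz`: every flow returns to ratio `7.000000`.
  - 40 LONG flows (40 000 sweeps): `1.00000` to five digits; the few slow ones approach `1` from
    ABOVE with diverging factors (border points of value exactly 7), none crosses (long_*.txt).
  - 150 flows SEEDED IN BORDER LAND: honest rank-6 tensors `ε^{-1}Σ u_l(ε)v_l(ε)w_l(ε)` of random
    valid order-1 schemes (five leading terms = a random rank-one syzygy in a random `2×2×2`
    subformat, built by a `2×2×2` GEVD; syzygy error `1e-15`; `ε ∈ {0.3, 0.1, 0.03, 0.01}`, factor
    norms up to `10³`): all end at `‖T − S‖² ∈ [1.0000, 1.004]` (two stuck at `2.0`), none below `1`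
    (borderseed.py, bs_*.txt).  Descent total: 1030 runs, minimum `1.00000`.
  - integer landscape: single/double `±1` moves from the exact maximiser `sixS` reach at most
    `6.40 / 6.23`; annealing over integer triads with entries `≤ 4` never exceeds `7` (int2_*.txt).
  - caveat for whoever reruns order-`h` scheme searches (kit job j010041 / scheme_als.py): penalty
    formulations `‖T − C_h‖² + μ Σ_{m<h} ‖C_m‖²` CHEAT by degenerating the gauge
    (`u₀ → λu₀, u₁ → λ⁻²u₁`: `C₀ → 0` with `C₁` of rank 18 fixed), so only the HONEST ratio of
    `S(ε) = ε^{-h} Σ u_l(ε)v_l(ε)w_l(ε)` may be trusted — the kit script records exactly that (`Mhon`).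
  - (cycle 2, § (e'')) BALANCED ALS (`num/ascent.py`: after every ALS sweep apply the optimal element of
    the stabiliser torus `𝕋 ⊂ G_T` — `ℓ(S)` is `G_T`-invariant, `‖τS‖²` is minimised by a 3-variable convex
    Newton step — i.e. ascent of `|ℓ|²/cap_𝕋`, which lifts the torus "swamps" where plain ALS must push
    factors to infinity): 192 random complex restarts × 1500 sweeps → max `7.000000000000`, 0 above
    (`camp_random_bal.txt`); 160 restarts seeded at stretched charts `τ·D₀` (`|log τ|∞ ≤ 3`, relative noise
    0.01–0.3) and at Bini-plus-one decompositions (`m ≤ 100`) → see `camp_stretched.txt` (0 above `7`).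
    Pencil-circle map `θ ↦ dist²(T_{e^{iθ}}, σ₆)` in `pencil_arc.txt` (§ (g)).
  WHY IT RESISTS (working hypothesis for the provers): the maximiser set of the ratio on `σ₆` is the
  6-real-dimensional orbit `{T − E_xyz}` of HONEST rank-6 tensors (value exactly 7, `T − S` a norm-one
  triad with `T(x,y,z) = 1`, i.e. a spectral-norm maximiser of `T`), it attracts every descent flow we
  ran, and no second critical value exists numerically; a certificate must therefore vanish on all of
  `(P¹)³` and be second-order tight there (along `P + sC₂`: `7 − 4s²`).
-/

set_option linter.dupNamespace false

namespace Summit.MatrixMultiplication.MatrixMultiplication.Cruxes.SevenEighthsLaw.Disproof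

open scoped BigOperators ComplexConjugate
open Literature.Computability.AlgebraicComplexity
open Summit.MatrixMultiplication.MatrixMultiplication.Theses.FidelityWitnesses (SevenEighthsLaw)

/-- index type of one tensor slot of `⟨2,2,2⟩` -/
abbrev P2 := Fin 2 × Fin 2

/-! ## Transfer: integer witnesses -/

/-- an integer tensor viewed over `ℂ` -/
def castT (Sz : P2 → P2 → P2 → ℤ) : P2 → P2 → P2 → ℂ := fun a b c => (Sz a b c : ℂ)

/-- overlap `⟨S, ⟨2,2,2⟩⟩` over `ℤ` -/
def overlapZ (Sz : P2 → P2 → P2 → ℤ) : ℤ := ∑ a, ∑ b, ∑ c, Sz a b c * matMulTensor ℤ 2 2 2 a b c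

/-- squared norm over `ℤ` -/
def normSqZ (Sz : P2 → P2 → P2 → ℤ) : ℤ := ∑ a, ∑ b, ∑ c, Sz a b c ^ 2

theorem overlap_castT (Sz : P2 → P2 → P2 → ℤ) :
    (∑ a, ∑ b, ∑ c, castT Sz a b c * matMulTensor ℂ 2 2 2 a b c) = (overlapZ Sz : ℂ) := by
  unfold overlapZ castT
  push_cast
  refine Finset.sum_congr rfl fun a _ => Finset.sum_congr rfl fun b _ =>
    Finset.sum_congr rfl fun c _ => ?_
  congr 1
  unfold matMulTensor
  split_ifs <;> simp

theorem normSq_castT (Sz : P2 → P2 → P2 → ℤ) :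
    (∑ a, ∑ b, ∑ c, ‖castT Sz a b c‖ ^ 2) = ((normSqZ Sz : ℤ) : ℝ) := by
  unfold normSqZ castT
  push_cast
  refine Finset.sum_congr rfl fun a _ => Finset.sum_congr rfl fun b _ =>
    Finset.sum_congr rfl fun c _ => ?_
  rw [Complex.norm_intCast, sq_abs]

theorem tensorRank_castT_le (Sz : P2 → P2 → P2 → ℤ) : tensorRank (castT Sz) ≤ tensorRank Sz :=
  tensorRank_map_le (Int.castRingHom ℂ) Sz

/-- The squared overlap and norm of an integer tensor, read over `ℂ`/`ℝ`. -/
theorem ratio_castT (Sz : P2 → P2 → P2 → ℤ) :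
    ‖∑ a, ∑ b, ∑ c, castT Sz a b c * matMulTensor ℂ 2 2 2 a b c‖ ^ 2 = ((overlapZ Sz ^ 2 : ℤ) : ℝ)
    ∧ (∑ a, ∑ b, ∑ c, ‖castT Sz a b c‖ ^ 2) = ((normSqZ Sz : ℤ) : ℝ) := by
  refine ⟨?_, normSq_castT Sz⟩
  rw [overlap_castT, Complex.norm_intCast, sq_abs]
  push_cast
  rfl

/-- **Transfer.** An integer tensor of rank `≤ r` with `7·‖S‖² < ⟨S,T⟩²` is a complex
counterexample at rank `r`; with `r = 6` this is `¬ SevenEighthsLaw` (`not_sevenEighthsLaw_of_int`). -/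
theorem violates_of_int (Sz : P2 → P2 → P2 → ℤ) (r : ℕ) (hr : tensorRank Sz ≤ r)
    (h : 7 * normSqZ Sz < overlapZ Sz ^ 2) :
    ∃ S : P2 → P2 → P2 → ℂ, tensorRank S ≤ r ∧
      7 * ∑ a, ∑ b, ∑ c, ‖S a b c‖ ^ 2 < ‖∑ a, ∑ b, ∑ c, S a b c * matMulTensor ℂ 2 2 2 a b c‖ ^ 2 := by
  refine ⟨castT Sz, (tensorRank_castT_le Sz).trans hr, ?_⟩
  rw [(ratio_castT Sz).1, (ratio_castT Sz).2]
  exact_mod_cast h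

/-- The shape of a kill: an integer rank-≤6 tensor beating `7`. -/
theorem not_sevenEighthsLaw_of_int (Sz : P2 → P2 → P2 → ℤ) (hr : tensorRank Sz ≤ 6)
    (h : 7 * normSqZ Sz < overlapZ Sz ^ 2) : ¬ SevenEighthsLaw := by
  intro hlaw
  obtain ⟨S, hS, hlt⟩ := violates_of_int Sz 6 hr h
  exact absurd (hlaw S hS) (not_le.mpr hlt)

/-! ## (a) Load-bearing analysis: the rank bound is the whole content -/

/-- `SevenEighthsLaw` with the rank hypothesis dropped. -/
def SevenEighthsLawWithoutRankBound : Prop :=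
  ∀ S : P2 → P2 → P2 → ℂ,
    ‖∑ a, ∑ b, ∑ c, S a b c * matMulTensor ℂ 2 2 2 a b c‖ ^ 2 ≤ 7 * ∑ a, ∑ b, ∑ c, ‖S a b c‖ ^ 2

/-- `SevenEighthsLaw` with rank `≤ 7` in place of `≤ 6`. -/
def SevenEighthsLawRankSeven : Prop :=
  ∀ S : P2 → P2 → P2 → ℂ, tensorRank S ≤ 7 →
    ‖∑ a, ∑ b, ∑ c, S a b c * matMulTensor ℂ 2 2 2 a b c‖ ^ 2 ≤ 7 * ∑ a, ∑ b, ∑ c, ‖S a b c‖ ^ 2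

theorem overlapZ_matMul : overlapZ (matMulTensor ℤ 2 2 2) = 8 := by decide
theorem normSqZ_matMul : normSqZ (matMulTensor ℤ 2 2 2) = 8 := by decide

theorem castT_matMul : castT (matMulTensor ℤ 2 2 2) = matMulTensor ℂ 2 2 2 := by
  funext a b c
  unfold castT matMulTensor
  split_ifs <;> simp

/-- `S = ⟨2,2,2⟩` itself: `64 > 56`.  Any proof must use the rank bound. -/
theorem false_without_rank_bound : ¬ SevenEighthsLawWithoutRankBound := by
  intro h
  have key := h (castT (matMulTensor ℤ 2 2 2))
  rw [(ratio_castT _).1, (ratio_castT _).2, overlapZ_matMul, normSqZ_matMul] at key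
  norm_num at key

/-- Strassen: `R(⟨2,2,2⟩) ≤ 7`, so rank `7` already reaches ratio `8 > 7`: the threshold `6` is sharp
on the rank side. -/
theorem false_with_rank_seven : ¬ SevenEighthsLawRankSeven := by
  intro h
  have hr : tensorRank (castT (matMulTensor ℤ 2 2 2)) ≤ 7 :=
    (tensorRank_castT_le _).trans (tensorRank_matMulTensor_two_le_seven ℤ)
  have key := h _ hr
  rw [(ratio_castT _).1, (ratio_castT _).2, overlapZ_matMul, normSqZ_matMul] at key
  norm_num at key

/-! ## (b) Tightness: the Bini-plus-one family `m·(T − E) + C₂` of honest rank ≤ 6 -/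

/-- indicator of position `(i, j)` on `P2`, over `ℤ` -/
def e (i j : Fin 2) : P2 → ℤ := fun p => if p = (i, j) then 1 else 0

/-- Z-slot factors (`γ`, output side; `c_{ki} ↦ position (i,k)`) of the six triads, parameter `m`. -/
def biniW (m : ℤ) : Fin 6 → P2 → ℤ :=
  ![e 0 1, m • e 0 0 + e 1 0, m • e 0 0 + m • e 0 1 + e 1 1, e 0 0, m • e 0 0 + e 1 1, e 1 0]

/-- X-slot factors (`α`, the `a_{ij}`): `(m a₁₂ + a₁₁), (m a₂₁ + a₁₁), −m a₁₂, −m a₂₁, a₁₂ + a₂₁, m a₂₂`. -/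
def biniU (m : ℤ) : Fin 6 → P2 → ℤ :=
  ![m • e 0 1 + e 0 0, m • e 1 0 + e 0 0, -(m • e 0 1), -(m • e 1 0), e 0 1 + e 1 0, m • e 1 1]

/-- Y-slot factors (`β`, the `b_{jk}`): `(m b₁₂ + b₂₂), b₁₁, b₁₂, (m b₁₁ + m b₁₂ + b₂₁), (m b₁₂ + b₂₁), b₂₁`. -/
def biniV (m : ℤ) : Fin 6 → P2 → ℤ :=
  ![m • e 0 1 + e 1 1, e 0 0, e 0 1, m • e 0 0 + m • e 0 1 + e 1 0, m • e 0 1 + e 1 0, e 1 0]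

/-- `biniS m = Σ_{r<6} biniW m r ⊗ biniU m r ⊗ biniV m r  (= m·(T − a₂₂⊗b₂₂⊗c₂₂) + C₂)`:
Bini's order-one scheme for `⟨2,2,2⟩ ∖ a₂₂` plus the honest term `m·a₂₂⊗b₂₁⊗c₁₂`, at `ε = 1/m`,
cleared of denominators. -/
def biniS (m : ℤ) : P2 → P2 → P2 → ℤ := fun a b c => ∑ r, biniW m r a * biniU m r b * biniV m r c

theorem tensorRank_biniS_le (m : ℤ) : tensorRank (biniS m) ≤ 6 :=
  tensorRank_le_of_eq_sum (biniW m) (biniU m) (biniV m)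
    (by funext a b c; simp [biniS, Finset.sum_apply, triad_apply])

theorem overlapZ_biniS (m : ℤ) : overlapZ (biniS m) = 7 * m := by
  simp [overlapZ, biniS, biniW, biniU, biniV, e, matMulTensor, Fintype.sum_prod_type,
    Fin.sum_univ_succ]
  ring

theorem normSqZ_biniS (m : ℤ) : normSqZ (biniS m) = 7 * m ^ 2 + 4 := by
  simp [normSqZ, biniS, biniW, biniU, biniV, e, Fintype.sum_prod_type, Fin.sum_univ_succ]
  ring

/-- The family in the crux's own terms: honest rank ≤ 6, overlap `7m`, norm² `7m² + 4`. -/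
theorem biniS_family (m : ℤ) : ∃ S : P2 → P2 → P2 → ℂ, tensorRank S ≤ 6 ∧
    ‖∑ a, ∑ b, ∑ c, S a b c * matMulTensor ℂ 2 2 2 a b c‖ ^ 2 = (7 * m) ^ 2 ∧
    (∑ a, ∑ b, ∑ c, ‖S a b c‖ ^ 2) = 7 * m ^ 2 + 4 := by
  refine ⟨castT (biniS m), (tensorRank_castT_le _).trans (tensorRank_biniS_le m), ?_, ?_⟩
  · rw [(ratio_castT _).1, overlapZ_biniS]; push_cast; ring
  · rw [(ratio_castT _).2, normSqZ_biniS]; push_cast; ring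

/-- **Tightness.** The constant `7` in `SevenEighthsLaw` cannot be lowered: for every `η > 0` some
honest rank-≤6 tensor has `(7 − η)·‖S‖² < |⟨S,T⟩|²` (ratio `7 − 28/(7m²+4)`). -/
theorem tight (η : ℝ) (hη : 0 < η) : ∃ S : P2 → P2 → P2 → ℂ, tensorRank S ≤ 6 ∧
    (7 - η) * ∑ a, ∑ b, ∑ c, ‖S a b c‖ ^ 2 < ‖∑ a, ∑ b, ∑ c, S a b c * matMulTensor ℂ 2 2 2 a b c‖ ^ 2 := by
  obtain ⟨m, hm⟩ := exists_nat_gt (28 / η)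
  obtain ⟨S, hS, h1, h2⟩ := biniS_family (m : ℤ)
  refine ⟨S, hS, ?_⟩
  rw [h1, h2]
  push_cast
  have hm0 : (0 : ℝ) ≤ m := Nat.cast_nonneg m
  have h28 : 28 < η * m := by rwa [div_lt_iff₀ hη, mul_comm] at hm
  nlinarith [mul_nonneg hm0 hm0, sq_nonneg ((m : ℝ)), h28, hη]

/-- The natural strengthening `7 ↦ 7 − 1/100` is FALSE. -/
theorem not_strengthened : ¬ (∀ S : P2 → P2 → P2 → ℂ, tensorRank S ≤ 6 →
    ‖∑ a, ∑ b, ∑ c, S a b c * matMulTensor ℂ 2 2 2 a b c‖ ^ 2 ≤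
      (7 - 1 / 100) * ∑ a, ∑ b, ∑ c, ‖S a b c‖ ^ 2) := by
  intro h
  obtain ⟨S, hS, hlt⟩ := tight (1 / 100) (by norm_num)
  exact absurd (h S hS) (not_le.mpr hlt)

/-! ## (b') The supremum `7` is ATTAINED by an honest integer rank-6 tensor: `⟨2,2,2⟩ − a₂₂⊗b₂₂⊗c₂₂` -/


/-- A vector on `P2` from its four values at `(0,0), (0,1), (1,0), (1,1)`. [folklore] -/
def vec4 (v00 v01 v10 v11 : ℤ) : P2 → ℤ := fun p => ![![v00, v01], ![v10, v11]] p.1 p.2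

/-- Z-slot factors of Strassen's algorithm transported by the isotropy element
`(g,h,k) = ([[1,0],[1,1]], [[0,1],[1,0]], [[1,1],[0,1]])` that moves Strassen's product
`M₆ = (A₂₁ − A₁₁)(B₁₁ + B₁₂)` onto the standard term `a₂₂⊗b₂₂⊗c₂₂`; the six OTHER products.
[cite: Strassen1969] -/
def sixW : Fin 6 → P2 → ℤ :=
  ![vec4 1 1 (-1) 0, vec4 0 0 1 0, vec4 0 1 0 0, vec4 1 1 0 0, vec4 (-1) 0 1 0, vec4 1 1 (-1) (-1)]

/-- X-slot factors of the six transported Strassen products. [cite: Strassen1969] -/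
def sixU : Fin 6 → P2 → ℤ :=
  ![vec4 1 1 1 0, vec4 1 1 1 1, vec4 0 1 0 0, vec4 1 0 1 0, vec4 1 1 0 0, vec4 0 0 (-1) 0]

/-- Y-slot factors of the six transported Strassen products. [cite: Strassen1969] -/
def sixV : Fin 6 → P2 → ℤ :=
  ![vec4 (-1) 1 1 0, vec4 0 0 1 0, vec4 1 (-1) (-1) 1, vec4 1 0 (-1) 0, vec4 (-1) 1 0 0, vec4 0 1 0 0]

/-- `sixS = Σ_{r<6} sixW r ⊗ sixU r ⊗ sixV r`, an honest integer rank-`≤ 6` tensor. [cite: Strassen1969] -/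
def sixS : P2 → P2 → P2 → ℤ := fun a b c => ∑ r, sixW r a * sixU r b * sixV r c

/-- **`R(⟨2,2,2⟩ − a₂₂⊗b₂₂⊗c₂₂) ≤ 6`**: the six transported Strassen products sum to `⟨2,2,2⟩` minus
the standard term at `((1,1),(1,1),(1,1))` (all `64` entries, by `decide`). [cite: Strassen1969] -/
theorem sixS_eq : sixS = fun a b c =>
    matMulTensor ℤ 2 2 2 a b c - (if a = (1, 1) ∧ b = (1, 1) ∧ c = (1, 1) then 1 else 0) := by
  decide

/-- The integer rank certificate `R(sixS) ≤ 6`. [cite: Strassen1969] -/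
theorem tensorRank_sixS_le : tensorRank sixS ≤ 6 :=
  tensorRank_le_of_eq_sum sixW sixU sixV (by funext a b c; simp [sixS, Finset.sum_apply, triad_apply])

/-- Overlap `7` and squared norm `7`: ratio exactly `7`. [folklore] -/
theorem sixS_vals : overlapZ sixS = 7 ∧ normSqZ sixS = 7 := by decide


/-- **Equality in `SevenEighthsLaw` is attained by an honest rank-6 tensor**: for
`S = ⟨2,2,2⟩ − a₂₂⊗b₂₂⊗c₂₂` (rank `≤ 6`: Strassen's algorithm has, in adapted coordinates, a
standard term as one of its seven products), `‖S‖² = 7` and `|⟨S,⟨2,2,2⟩⟩|² = 49 = 7·‖S‖²`.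
So `M(2,6) ≥ 7` is a MAXIMUM over honest rank-6 tensors, not only a supremum, and any certificate of
the crux must be tight at `S` (and along its 6-real-dimensional orbit `⟨2,2,2⟩ − E_{xyz}` under the
compact stabiliser). [cite: Strassen1969] -/
theorem attained : ∃ S : P2 → P2 → P2 → ℂ, tensorRank S ≤ 6 ∧
    (∑ a, ∑ b, ∑ c, ‖S a b c‖ ^ 2) = 7 ∧
    ‖∑ a, ∑ b, ∑ c, S a b c * matMulTensor ℂ 2 2 2 a b c‖ ^ 2 = 7 * ∑ a, ∑ b, ∑ c, ‖S a b c‖ ^ 2 := by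
  refine ⟨castT sixS, (tensorRank_castT_le _).trans tensorRank_sixS_le, ?_, ?_⟩
  · rw [(ratio_castT _).2, sixS_vals.2]; push_cast; ring
  · rw [(ratio_castT _).1, (ratio_castT _).2, sixS_vals.1, sixS_vals.2]; push_cast; norm_num


/-! ## (b'') Border-side tangency: the two-parameter Bini-plus-honest family stays STRICTLY below 7

`biniS2 m k = m·(Bini order-one scheme for ⟨2,2,2⟩ ∖ a₂₂ at ε = 1/m, cleared) + k·(a₂₂ ⊗ b₂₁ ⊗ c₁₂)`
(`biniS m = biniS2 m m`).  Exactly: `overlapZ = 6m + k`, `normSqZ = 6m² + k² + 4`, and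
`7·normSqZ − overlapZ² = 6(m − k)² + 28 > 0`.  So the generic BORDER mechanism "border-rank-5 scheme
for six units + one honest unit" approaches the constant `7` only in the limit `m → ∞` and only
tangentially at `k = m` (honest weight = scheme weight): in the scale-free variable `t = k/m` the
limiting ratio is `(6 + t)²/(6 + t²) = 7 − 6(t − 1)²/(6 + t²)` — a quadratic well at `t = 1`, the border
counterpart of the second-order rigidity of the honest maximiser `T − E` (§ (f)).  (cycle 2) -/

/-- X-slot factors with the honest sixth product weighted `k` instead of `m`. -/
def biniU2 (m k : ℤ) : Fin 6 → P2 → ℤ :=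
  ![m • e 0 1 + e 0 0, m • e 1 0 + e 0 0, -(m • e 0 1), -(m • e 1 0), e 0 1 + e 1 0, k • e 1 1]

/-- `biniS2 m k`: Bini's five-product order-one scheme (weight `m`) plus the honest product
`k · a₂₂ ⊗ b₂₁ ⊗ c₁₂`; an honest integer tensor of rank `≤ 6`. -/
def biniS2 (m k : ℤ) : P2 → P2 → P2 → ℤ := fun a b c => ∑ r, biniW m r a * biniU2 m k r b * biniV m r c

theorem tensorRank_biniS2_le (m k : ℤ) : tensorRank (biniS2 m k) ≤ 6 :=
  tensorRank_le_of_eq_sum (biniW m) (biniU2 m k) (biniV m)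
    (by funext a b c; simp [biniS2, Finset.sum_apply, triad_apply])

theorem overlapZ_biniS2 (m k : ℤ) : overlapZ (biniS2 m k) = 6 * m + k := by
  simp [overlapZ, biniS2, biniW, biniU2, biniV, e, matMulTensor, Fintype.sum_prod_type,
    Fin.sum_univ_succ]
  ring

theorem normSqZ_biniS2 (m k : ℤ) : normSqZ (biniS2 m k) = 6 * m ^ 2 + k ^ 2 + 4 := by
  simp [normSqZ, biniS2, biniW, biniU2, biniV, e, Fintype.sum_prod_type, Fin.sum_univ_succ]
  ring

/-- **Border-side deficit identity**: `7‖S‖² − ⟨S,T⟩² = 6(m − k)² + 28` on the whole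
two-parameter Bini-plus-honest family. -/
theorem biniS2_deficit (m k : ℤ) :
    7 * normSqZ (biniS2 m k) - overlapZ (biniS2 m k) ^ 2 = 6 * (m - k) ^ 2 + 28 := by
  rw [overlapZ_biniS2, normSqZ_biniS2]; ring

/-- Hence no member of the family is a counterexample (the kill switch `not_sevenEighthsLaw_of_int`
never fires on it): the family realises `7` only as a limit, from strictly below. -/
theorem biniS2_below (m k : ℤ) : overlapZ (biniS2 m k) ^ 2 < 7 * normSqZ (biniS2 m k) := by
  have h := biniS2_deficit m k
  nlinarith [sq_nonneg (m - k)]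

/-! ## (f) Torus-uniform second variation at `S₀ = T − E` (cycle 2; exact, scripts `num/torus_hessian.py`,
`num/null_dirs.py` attached as item evidence) — closes the "indefinite Hessian at ⟨2,2,2⟩ − e" kill route
on EVERY chart of `S₀`, including the stretched charts whose ends are the Bini border schemes.

Set-up.  `G_T ≅ GL₂³/ℂ*` acts on triads by `(w,u,v) ↦ (P⁻ᵀ w Rᵀ, P u Q⁻¹, Q v R⁻¹)`; the overlap
`ℓ(S) = Σ S·T = Σ_l tr(w_lᵀ u_l v_l)` is `G_T`-invariant, the norm is not.  `Stab_{G_T}(S₀) = Stab(E)` is the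
diagonal torus, acting on `ℂ⁶⁴` through the 3-dimensional torus `𝕋 = {τ = (a,b,c)}` with weight
`a^{[κ'=2]−[κ=2]} b^{[μ'=2]−[μ=2]} c^{[ν=2]−[ν'=2]}` on `z_{κν} ⊗ x_{κ'μ} ⊗ y_{μ'ν'}` (so `supp T` has weight 0).
By de Groote (all rank-7 decompositions of `T` are isotropy-equivalent; the `I⊗I⊗I` product of Strassen is
never a unit tensor) the honest 6-term decompositions of `S₀` form the single non-compact family `𝕋·D₀`
(`D₀ = (sixW, sixU, sixV)`; Terracini rank 57 on all of it, triage F1).  For a chart `τ·D₀` and a direction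
`δ ∈ ℂ⁷²` put `X₁ = dΦ(δ)`, `X₂ = ½d²Φ(δ,δ)`; then EXACTLY (Φ is trilinear)
  `ratio(τ·Φ(D₀ + sδ)) = 7 + 2 Re(s² q(δ)) − |s|²·h_τ(δ) + O(|s|³)`,
  `q(δ) = ⟨X₂,E⟩ = δw₃(22)δu₃(22) + δw₂(22)δv₂(22) − δu₆(22)δv₆(22)`,  `h_τ(δ) = ‖(τX₁)^{⊥S₀}‖²`
(first order vanishes on every chart: `⟨X₁,E⟩ ≡ 0`, `⟨τX, S₀⟩ = ⟨X, S₀⟩`).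
RESULT (exact rational linear algebra + float eigenvalues, all τ on a 13³ log-grid and by the closed form
below): the Schur complement of the Gram form of `h_τ` onto the six `E`-touching coordinates is
  `G̃_τ = diag(a⁻², a², c², c⁻², b⁻², b²)`   (pairs `(δw₃,δu₃), (δw₂,δv₂), (δu₆,δv₆)` at entry 22),
so `h_τ(δ) ≥ a⁻²|δ₁|² + a²|δ₂|² + … ≥ 2(|δ₁δ₂| + |δ₃δ₄| + |δ₅δ₆|) ≥ 2|q(δ)|` for EVERY `τ` (AM–GM): the
second variation `sup_θ [2Re(e^{2iθ}q) − h_τ] = 2|q| − h_τ` is `≤ 0` on all charts, `λ_max = 0` exactly.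
NULL DIRECTIONS = SYMMETRY: equality forces `X₁(δ) ∈ 𝔤_T·S₀ + ℂ·S₀` (checked: `dist < 2·10⁻¹¹` for the
spanning null vectors; `dim 𝔤_T·S₀ = 6`), i.e. the flat directions are the tangents of the orbit
`G_T·ℂ*·S₀`, along which the ratio is `49/(6 + ‖gE‖²) ≤ 7` with equality iff `g ∈ K` — so third order
carries nothing new (reparametrise by `exp(−sξ)`), and `S₀` is second-order rigid MODULO `G_T` uniformly
over the non-compact chart family.  What this does NOT cover: sheets of `σ̂₆` at `S₀` reachable only through
divergent decompositions not of the form `τ·(D₀ + o(1))` (the Bini line `S₀ + ℂC₂` is of that form: § (b''),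
second-order coefficient `−4`), and anything non-local.  Two chart-free checks of exactly that (cycle 2):
(i) DECOMPOSITION CENSUS of `S₀` — ALS with target `S₀` from 80 random starts × 16 000 sweeps: all 28 runs that
reach machine precision end with `D₀`'s signature (factor ranks `(1,1,1)×5 + (2,2,2)`, supports `4,4,4,8,8,27`);
the other signatures seen are transients converging linearly to the degenerate fibre — ONE honest family, as de
Groote predicts (`num/decomp_families.py`); (ii) SLICE-REGION PROBE — in the affine family `S_q := T′ + q⊗z₂₂`
(`T′ = T` minus its `z₂₂`-slice, `q ∈ X⊗Y`; ratio `ρ(q) = |6 + q_{21,12} + q_{22,22}|²/(6 + ‖q‖²)`, tight set ∋ the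
rank-one `q` with `(uv)₂₂ = 1`; `{q : bR(S_q) ≤ 6}` has dimension `≥ 12` at `q₀ = x₂₁⊗y₁₂` by the codimension-4
count, far more than the rank-one `q`), 252 points `q = q₀′ + ηd` INSIDE `{ρ > 7}` (`η = 0.3 … 0.01`, random `d`,
random tight `q₀′`) were projected back to `σ₆` by ALS (far decompositions allowed): `dist²(S_q, σ₆)/η² ≥ 0.08`
(transversal) and the ratio of the nearest rank-6 point is ALWAYS `< 7`, with deficit `7 − ratio ≈ 0.47·η²`
(`6.99995` at `η = 0.01`; `num/slice_region.py`) — second-order rigidity seen from the border side without charts.  For the provers: the local certificate at `S₀` is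
the PSD form `7 JᵀJ − (JᵀS₀)(JᵀS₀)ᵀ ∓ 14·Q_sym ⪰ 0` on `ℝ⁷²` (integer matrix from `sixW/U/V`; kernel =
gauge ⊕ 𝔱 ⊕ orbit), and its `τ`-twisted versions are PSD by the SAME diagonal AM–GM — one identity, not a
family of LDLᵀ's. -/

/-! ## (g) Isotope sensitivity (cycle 2): the bound `7` is special to the ASSOCIATIVE point of the pencil

For `χ ∈ ℂ` let `T_χ := T + (χ − 1)·E` (structure tensor of the isotope with `e₂₂·e₂₂ = χ e₂₂`; same
support, same torus weights, `‖T_χ‖² = 7 + |χ|²`; `bR(T_χ) = 7` for `χ ≠ 0` by triage F5/ParametricSeven,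
numerically) and `M(χ) := sup_{R(S) ≤ 6} |⟨S,T_χ⟩|²/‖S‖²`.  Facts: `M` is CONVEX on `ℂ` (a sup of
`|affine|²`), `M ≥ 7` everywhere (`S = T − E`: `|⟨T − E, T_χ⟩|² = 49 = 7‖T − E‖²`), `M(0) = 7` exactly
(Cauchy–Schwarz, `‖T₀‖² = 7`), and `M(χ) ≥ |6 + χ|²/7` (`S = T − E′`, `E′ ≠ E`), so the tight set
`Ω := {M = 7} = {M ≤ 7}` is a compact CONVEX set with `0 ∈ Ω ⊂ {|6 + χ| ≤ 7}`; the crux is `1 ∈ Ω`, and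
`1 ∈ ∂{|6+χ| ≤ 7}` — the law has no slack in `χ` beyond `1` on the real axis.  Numerics (ALS, 16–24
restarts × 600–2500 sweeps per point, `num/pencil_target.py`): on the unit circle `χ = e^{iθ}`,
`M(e^{iθ}) − 7 ≈ 0.2057 (θ = π), 0.0904 (2), 0.0159 (1), 0.0079 (0.7), 0.0057 (0.6), 0.0040 (0.5),
0.0025 (0.4), 0.0014 (0.3), 0.0005 (0.2)` = `0.0158·θ² (±3 %)` for `θ ≤ 1` (`pencil_arc*.txt`; short runs
UNDER-estimate `M`, all values are lower bounds): the tight set `Ω` meets the unit circle only at `χ = 1`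
(quadratic departure), `Ω ∩ ℝ ≈ [−0.9, 1]` (cycle 1 § (d): second branch `dist² ≈ 0.8` wins for `u < −0.9`),
and the unimodular isotope law FAILS at every sampled `θ ≠ 0`, worst at `θ = π`: `M(−1) ≥ 7.2057` (border
supremum; honest integer witness below with ratio `7.0386`).  No kill from this side: with `S_θ` optimal for
`T_{e^{iθ}}`, `ratio_T(S_θ) ≥ (√M − |1 − e^{iθ}|)² ≈ 7 − 2√7·θ + …` — the excess would have to be LINEAR in
`θ` with slope `> 2√7` to transfer to `T`; it is quadratic with coefficient `0.016`.
Moral for certificates: support, torus weights, flattening spectra and border rank 7 are shared by all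
unimodular `T_χ`; a proof of `SevenEighthsLaw` must use the sign structure (associativity) of `⟨2,2,2⟩`,
and must NOT prove the analogous bound for `T₋₁ = T − 2E`. -/

/-- The isotope pencil `T_χ = ⟨2,2,2⟩ + (χ − 1)·z₂₂⊗x₂₂⊗y₂₂`. -/
def isotope (χ : ℂ) : P2 → P2 → P2 → ℂ := fun a b c =>
  matMulTensor ℂ 2 2 2 a b c + (χ - 1) * (if a = (1, 1) ∧ b = (1, 1) ∧ c = (1, 1) then 1 else 0)

/-- The `SevenEighthsLaw`-shaped bound for the isotope `T_χ` (for `|χ| = 1` this is fidelity `≤ 7/8`). -/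
def IsotopeLaw (χ : ℂ) : Prop :=
  ∀ S : P2 → P2 → P2 → ℂ, tensorRank S ≤ 6 →
    ‖∑ a, ∑ b, ∑ c, S a b c * isotope χ a b c‖ ^ 2 ≤ 7 * ∑ a, ∑ b, ∑ c, ‖S a b c‖ ^ 2

theorem isotope_one : isotope 1 = matMulTensor ℂ 2 2 2 := by
  funext a b c; simp [isotope]

/-- At the associative point the isotope law IS the crux. -/
theorem isotopeLaw_one_iff : IsotopeLaw 1 ↔ SevenEighthsLaw := by
  unfold IsotopeLaw SevenEighthsLaw; rw [isotope_one]

/-- `T₋₁ = T − 2E` over `ℤ`. -/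
def isoT : P2 → P2 → P2 → ℤ := fun a b c =>
  matMulTensor ℤ 2 2 2 a b c - 2 * (if a = (1, 1) ∧ b = (1, 1) ∧ c = (1, 1) then 1 else 0)

theorem castT_isoT : castT isoT = isotope (-1) := by
  funext a b c
  unfold castT isoT isotope matMulTensor
  split_ifs <;> push_cast <;> norm_num

/-- overlap of two integer tensors -/
def overlapZW (Sz Tz : P2 → P2 → P2 → ℤ) : ℤ := ∑ a, ∑ b, ∑ c, Sz a b c * Tz a b c

theorem overlap_castT₂ (Sz Tz : P2 → P2 → P2 → ℤ) :
    (∑ a, ∑ b, ∑ c, castT Sz a b c * castT Tz a b c) = (overlapZW Sz Tz : ℂ) := by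
  unfold overlapZW castT; push_cast; rfl

/-- Z-slot factors of an honest integer rank-6 witness for `T₋₁` (found by real ALS + rounding + greedy
integer polish, `num/isotope_witness2.py`; entries `≤ 12`). -/
def isoW : Fin 6 → P2 → ℤ :=
  ![vec4 3 (-12) 0 3, vec4 5 (-12) (-2) (-2), vec4 (-3) (-11) 0 (-2), vec4 3 (-11) 2 (-4),
    vec4 3 8 (-3) (-7), vec4 5 8 3 (-3)]
/-- X-slot factors of the `T₋₁` witness. -/
def isoU : Fin 6 → P2 → ℤ :=
  ![vec4 (-4) 2 11 3, vec4 2 2 (-12) (-5), vec4 6 3 8 (-3), vec4 3 0 11 3, vec4 2 (-1) (-10) 3,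
    vec4 (-4) 2 (-8) 6]
/-- Y-slot factors of the `T₋₁` witness. -/
def isoV : Fin 6 → P2 → ℤ :=
  ![vec4 (-2) 3 10 (-7), vec4 3 0 12 (-4), vec4 (-3) (-2) (-9) (-4), vec4 6 (-3) 10 2,
    vec4 4 2 (-8) 4, vec4 (-2) 0 10 2]
/-- The honest integer rank-≤6 witness `isoS = Σ_r isoW r ⊗ isoU r ⊗ isoV r`. -/
def isoS : P2 → P2 → P2 → ℤ := fun a b c => ∑ r, isoW r a * isoU r b * isoV r c

theorem tensorRank_isoS_le : tensorRank isoS ≤ 6 :=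
  tensorRank_le_of_eq_sum isoW isoU isoV (by funext a b c; simp [isoS, Finset.sum_apply, triad_apply])

/-- Exact values: `⟨isoS, T − 2E⟩ = 2892`, `‖isoS‖² = 1188253`; `2892² = 8363664 > 8317771 = 7·1188253`
(ratio `7.0386…`; its ratio against `T` itself is only `2350²/1188253 ≈ 4.65`). -/
theorem isoS_vals : overlapZW isoS isoT = 2892 ∧ normSqZ isoS = 1188253 := by decide

/-- **The unimodular isotope law fails at `χ = −1`:** some honest rank-≤6 tensor has fidelity `> 7/8`
with `T − 2·z₂₂⊗x₂₂⊗y₂₂` (same support, weights and norm as `⟨2,2,2⟩`). -/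
theorem not_isotopeLaw_neg_one : ¬ IsotopeLaw (-1) := by
  intro h
  have key := h (castT isoS) ((tensorRank_castT_le _).trans tensorRank_isoS_le)
  rw [← castT_isoT, overlap_castT₂, (ratio_castT isoS).2, isoS_vals.1, isoS_vals.2,
    Complex.norm_intCast] at key
  norm_num at key

/-! ## (h) Load-bearing analysis of the lead's hard stub `stub_capHardRegime` (cycle 3)

The picked line `singlet-fraction-transfer` (lead prover-line-…-4959-0, skeleton be34014739a5) reduces the crux to
`stub_capHardRegime : ∀ u v e, e orthonormal 6-frame of X ⊗ Y → e ⊂ span{u_l ⊗ v_l} → 3 < finrank span{m(e_s)} →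
cap e ≤ 7` (`cap e = Σ_s Σ_a |Σ_μ e_s (a.1,μ) (μ,a.2)|² = 2 tr(P_E Π_W)`, `W` = slice space of `⟨2,2,2⟩`).
Hypothesis by hypothesis: (1) PRODUCT-SPANNEDNESS `hps` is load-bearing — dropped, the statement is false at the
rational orthonormal frame `wFrame` below (an orthonormal basis of `W` plus two unit vectors outside `W`: hard regime,
`finrank = 4`, `cap = 8`), `capHardRegime_false_without_productSpan`; `cap = 8 ⟺ W ⊆ E`, which for product-spanned
`E` is exactly `R(⟨2,2,2⟩) ≤ 6` — so the rank bound enters the hard stub at its very first step, not only through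
"six products"; (2) `3 < finrank` is NOT load-bearing (dropping it gives the full E-picture `cap ≤ 7`, true in the
easy regime by Bessel, `stub_capEasyRegime`); (3) orthonormality is scale-normalisation.  The three "provable now"
stubs were checked on paper (refuter): `stub_sliceElimination` (bilinear pairing with the real `T`, Parseval inside
`span e`, Cauchy–Schwarz over `P2 × Fin k` — true for every `k`), `stub_productFrame` (pad a maximal independent
subfamily of the `u_l ⊗ v_l` by standard products, Gram–Schmidt — true), `stub_capEasyRegime`
(`cap = ‖m ∘ ι_E‖²_HS ≤ ‖m‖²_op · rank = 2 · finrank` — true for every `k`).  Landed for import as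
`…Theorems.SevenEighthsLaw.Negative.CapWithoutProducts` (p84809 ACCEPTED, commit 5f52a26c2cf9). -/

/-- `stub_capHardRegime` of `Lines/singlet-fraction-transfer.lean` with the product-span hypothesis `hps` dropped. -/
def CapHardRegimeWithoutProductSpan : Prop :=
  ∀ e : Fin 6 → (Fin 2 × Fin 2) → (Fin 2 × Fin 2) → ℂ,
    (∀ s t : Fin 6, (∑ b, ∑ c, conj (e s b c) * e t b c) = if s = t then 1 else 0) →
    3 < Module.finrank ℂ (Submodule.span ℂ (Set.range fun s : Fin 6 =>
        fun a : Fin 2 × Fin 2 => ∑ μ : Fin 2, e s (a.1, μ) (μ, a.2))) →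
    ∑ s, ∑ a : Fin 2 × Fin 2, ‖∑ m : Fin 2, e s (a.1, m) (m, a.2)‖ ^ 2 ≤ 7

/-- Twice the witness frame, over `ℤ`: rows 0–3 are `(δ₀₀ ± δ₁₁) ⊗ I`, `(δ₀₁ ± δ₁₀) ⊗ I` (an orthogonal basis of
the slice space `W = {q ⊗ I₂}` of `⟨2,2,2⟩`, each of norm 2), rows 4–5 two vectors of norm 2 outside `W`. -/
def wTab (s : Fin 6) (b c : P2) : ℤ :=
  match s with
  | 0 => if b.2 = c.1 ∧ b.1 = c.2 then 1 else 0
  | 1 => if b.2 = c.1 ∧ b.1 = c.2 then (if b.1 = 0 then 1 else -1) else 0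
  | 2 => if b.2 = c.1 ∧ b.1 ≠ c.2 then 1 else 0
  | 3 => if b.2 = c.1 ∧ b.1 ≠ c.2 then (if b.1 = 0 then 1 else -1) else 0
  | 4 => if b = (0, 0) ∧ c = (1, 0) then 2 else 0
  | 5 => if b = (0, 0) ∧ c = (1, 1) then 2 else 0

/-- The witness frame `wFrame = wTab / 2`. -/
noncomputable def wFrame (s : Fin 6) (b c : P2) : ℂ := (wTab s b c : ℂ) / 2

theorem wTab_gram : ∀ s t : Fin 6, (∑ b, ∑ c, wTab s b c * wTab t b c) = if s = t then 4 else 0 := by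
  decide

/-- `wFrame` is orthonormal. -/
theorem wFrame_orthonormal (s t : Fin 6) :
    (∑ b, ∑ c, conj (wFrame s b c) * wFrame t b c) = if s = t then 1 else 0 := by
  have h : (∑ b, ∑ c, conj (wFrame s b c) * wFrame t b c)
      = ((∑ b, ∑ c, wTab s b c * wTab t b c : ℤ) : ℂ) / 4 := by
    unfold wFrame
    push_cast
    rw [Finset.sum_div]
    refine Finset.sum_congr rfl fun b _ => ?_
    rw [Finset.sum_div]
    refine Finset.sum_congr rfl fun c _ => ?_
    simp only [map_div₀, map_intCast, map_ofNat]
    ring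
  rw [h, wTab_gram s t]
  split_ifs <;> norm_num

/-- The multiplied vectors `m(wFrame s)(a) = Σ_μ wFrame s (a.1,μ) (μ,a.2)`, tabulated (integer values). -/
def mvTab (s : Fin 6) (a : P2) : ℤ :=
  match s with
  | 0 => if a.1 = a.2 then 1 else 0
  | 1 => if a.1 = a.2 then (if a.1 = 0 then 1 else -1) else 0
  | 2 => if a.1 ≠ a.2 then 1 else 0
  | 3 => if a.1 ≠ a.2 then (if a.1 = 0 then 1 else -1) else 0
  | 4 => 0
  | 5 => 0

theorem mTab_eq : ∀ s : Fin 6, ∀ a : P2, (∑ μ : Fin 2, wTab s (a.1, μ) (μ, a.2)) = 2 * mvTab s a := by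
  decide

theorem mv_eq (s : Fin 6) (a : P2) : (∑ μ : Fin 2, wFrame s (a.1, μ) (μ, a.2)) = (mvTab s a : ℂ) := by
  have h : (∑ μ : Fin 2, wFrame s (a.1, μ) (μ, a.2)) = ((∑ μ : Fin 2, wTab s (a.1, μ) (μ, a.2) : ℤ) : ℂ) / 2 := by
    unfold wFrame; push_cast; rw [Finset.sum_div]
  rw [h, mTab_eq s a]; push_cast; ring

theorem mvTab_sq_sum : (∑ s : Fin 6, ∑ a : P2, mvTab s a ^ 2) = 8 := by decide

/-- `cap wFrame = 8`. -/
theorem cap_wFrame : (∑ s, ∑ a : Fin 2 × Fin 2, ‖∑ m : Fin 2, wFrame s (a.1, m) (m, a.2)‖ ^ 2) = 8 := by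
  have h : (∑ s, ∑ a : Fin 2 × Fin 2, ‖∑ m : Fin 2, wFrame s (a.1, m) (m, a.2)‖ ^ 2)
      = ((∑ s : Fin 6, ∑ a : P2, mvTab s a ^ 2 : ℤ) : ℝ) := by
    push_cast
    refine Finset.sum_congr rfl fun s _ => Finset.sum_congr rfl fun a _ => ?_
    rw [mv_eq, Complex.norm_intCast, sq_abs]
  rw [h, mvTab_sq_sum]; norm_num

/-- The multiplied vectors of `wFrame` span all of `ℂ^{P2}`. -/
theorem span_mv_wFrame_eq_top :
    Submodule.span ℂ (Set.range fun s : Fin 6 => fun a : Fin 2 × Fin 2 => ∑ μ : Fin 2, wFrame s (a.1, μ) (μ, a.2))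
      = ⊤ := by
  set V := Submodule.span ℂ (Set.range fun s : Fin 6 =>
    fun a : Fin 2 × Fin 2 => ∑ μ : Fin 2, wFrame s (a.1, μ) (μ, a.2)) with hV
  have hm : ∀ s : Fin 6, (fun a : P2 => (mvTab s a : ℂ)) ∈ V := by
    intro s
    have h1 : (fun a : Fin 2 × Fin 2 => ∑ μ : Fin 2, wFrame s (a.1, μ) (μ, a.2)) ∈ V :=
      Submodule.subset_span ⟨s, rfl⟩
    convert h1 using 1
    funext a
    exact (mv_eq s a).symm
  have hδ : ∀ a₀ : P2, (fun a : P2 => if a₀ = a then (1 : ℂ) else 0) ∈ V := by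
    intro a₀
    have h01 := V.add_mem (hm 0) (hm 1)
    have h01' := V.sub_mem (hm 0) (hm 1)
    have h23 := V.add_mem (hm 2) (hm 3)
    have h23' := V.sub_mem (hm 2) (hm 3)
    rcases a₀ with ⟨i, j⟩
    fin_cases i <;> fin_cases j
    · convert V.smul_mem (1 / 2 : ℂ) h01 using 1
      funext a; rcases a with ⟨k, l⟩; fin_cases k <;> fin_cases l <;> norm_num [mvTab]
    · convert V.smul_mem (1 / 2 : ℂ) h23 using 1
      funext a; rcases a with ⟨k, l⟩; fin_cases k <;> fin_cases l <;> norm_num [mvTab]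
    · convert V.smul_mem (1 / 2 : ℂ) h23' using 1
      funext a; rcases a with ⟨k, l⟩; fin_cases k <;> fin_cases l <;> norm_num [mvTab]
    · convert V.smul_mem (1 / 2 : ℂ) h01' using 1
      funext a; rcases a with ⟨k, l⟩; fin_cases k <;> fin_cases l <;> norm_num [mvTab]
  refine Submodule.eq_top_iff'.mpr fun v => ?_
  rw [pi_eq_sum_univ v]
  exact V.sum_mem fun a _ => V.smul_mem _ (hδ a)

theorem finrank_span_mv_wFrame :
    Module.finrank ℂ (Submodule.span ℂ (Set.range fun s : Fin 6 =>
      fun a : Fin 2 × Fin 2 => ∑ μ : Fin 2, wFrame s (a.1, μ) (μ, a.2))) = 4 := by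
  rw [span_mv_wFrame_eq_top, finrank_top, Module.finrank_fintype_fun_eq_card]
  rfl

/-- **Load-bearing for the hard stub.** Without product-spannedness `stub_capHardRegime` is false: the frame
`wFrame` (orthonormal basis of the slice space `W` of `⟨2,2,2⟩` plus two unit vectors outside `W`) is in the hard
regime (`dim span m(e) = 4`) and has `cap = 8 > 7`.  Any proof of the hard stub must use that `E` is spanned by
six rank-one matrices (equivalently: `W ⊄ E` for product-spanned `E`, i.e. `bR(⟨2,2,2⟩) > 6`, is where it starts). -/
theorem capHardRegime_false_without_productSpan : ¬ CapHardRegimeWithoutProductSpan := by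
  intro h
  have key := h wFrame wFrame_orthonormal (by rw [finrank_span_mv_wFrame]; norm_num)
  rw [cap_wFrame] at key
  norm_num at key


/-! ## (i) Principal-angle profile of product 6-planes against `W` (cycle 3; numerics + one exact configuration)

E-picture: for a 6-plane `E ⊂ X ⊗ Y = ℂ⁴ ⊗ ℂ⁴` spanned by six rank-one matrices `x_l ⊗ y_l`, let
`1 ≥ λ₁ ≥ λ₂ ≥ λ₃ ≥ λ₄ ≥ 0` be the eigenvalues of `B = P_W P_E P_W |_W` (`cos²` of the principal angles between `E`
and the 4-dimensional slice space `W = {q ⊗ I₂}`); `cap = 2(λ₁+λ₂+λ₃+λ₄)` and the crux is `λ₁+λ₂+λ₃+λ₄ ≤ 7/2`.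
KY-FAN PROFILE (pure-python analytic-gradient ascent with annealed soft-min, `num/eplane.py`, 30–100 restarts per
objective; every value below is attained to `1e-9` and NEVER exceeded):
  `sup λ₄ = 3/4`,  `sup (λ₃+λ₄) = 3/2`,  `sup (λ₂+λ₃+λ₄) = 5/2`,  `sup (λ₁+…+λ₄) = 7/2`.
* `sup λ₄ = 3/4` REFUTES the "fourth-angle law" `λ₄ ≤ 1/2` (the tempting one-witness certificate: some slice
  direction `q` with `‖P_E(q⊗I)‖² ≤ ½‖q⊗I‖²`, which with `λ₁,λ₂,λ₃ ≤ 1` would give the crux with its exact tight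
  profile `(1,1,1,½)`).  In the lead's graph coordinates (`E = graph L ⊕ E_K`, `λ = 1/(1+s(L)²)`): the sharp
  single-witness statement is `s_max(L)² ≥ 1/3`, NOT `≥ 1` — and `1/3` alone only gives `cap ≤ 7.5`.
  EXACT ISOTROPIC PLANE (all four `cos² = 3/4`, `cap = 6`; `num/iso_plane.py`, `B = ¾·I₄` to machine precision, and
  by the symmetry argument below exactly): `E_iso = |0⟩_κ ⊗ F ⊕ |1⟩_κ ⊗ F` with, in `ℂ²_μ ⊗ (ℂ²_μ' ⊗ ℂ²_ν)`,
  `F = span{ R^k|0⟩ ⊗ (R^k ⊗ R^k)(3|00⟩ − |11⟩) : k = 0,1,2 }`, `R` = rotation by `2π/3` — an `S₃`-orbit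
  (`S₃` acting by its 2-dimensional irrep on `μ`, `μ'`, `ν` simultaneously fixes `Φ_{μμ'} ⊗ ℂ²_ν = W`-block and acts
  irreducibly on `ℂ²_ν`, which forces `P_G P_F P_G` to be scalar; the scalar is `3/4` exactly at the 3-4-5 point
  `tan(θ/2) = 1/3`, i.e. `y₀ ∝ 3|00⟩ − |11⟩`).  The six products are `x_{k,κ} = |κ⟩ ⊗ R^k|0⟩` (rank-one `2×2`),
  `y_k = (R^k⊗R^k)(3,0,0,−1)/√10` (NOT rank-one).  `F` is defined over `ℚ` (basis `|0⟩(3,0,0,−1)`,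
  `−2|0⟩e₁₁ − 3|1⟩(e₀₁+e₁₀)`, `|0⟩(e₀₁+e₁₀) + 2|1⟩e₁₁`) but its only product lines are the three trine points, a
  Galois-conjugate pair over `ℚ(√3)` — no Gaussian-rational product basis (3 is not a norm from `ℚ(i)`), which is why
  this configuration is recorded here and not (yet) as a `decide`d Negative lemma (route: `ℤ√3`-valued Gram/adjugate
  identity `Wᵀ M adj(G) Mᵀ W = ¾ det G · I`).
* `sup (λ₃+λ₄) = 3/2`: the TWO-ANGLE LAW `λ₃ + λ₄ ≤ 3/2` ("some orthonormal PAIR `w, w' ∈ W` has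
  `‖P_E w‖² + ‖P_E w'‖² ≤ 3/2`") is numerically TRUE and SHARP, tight on TWO distinct strata — the crux maximisers
  (`(1,1,1,½)`: `1 + ½`) and the isotropic planes (`¾ + ¾`) — and the ascent flows of `λ₃+λ₄` end on both (26/40 iso,
  14/40 Strassen in `two_run2.txt`), 0/100 above `1.5 + 1e-7`.  It IMPLIES the crux (`λ₁,λ₂ ≤ 1`) and is strictly
  stronger; in graph coordinates: the two largest singular values of `L` satisfy
  `s₃²/(1+s₃²) + s₄²/(1+s₄²) ≥ 1/2` (tight at `(0,1)` and `(⅓,⅓)`).  Local check at the Strassen-six plane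
  (`num/local_two2.py`): first order vanishes (λ₄ = cap/2 − λ₁ − λ₂ − λ₃ is critical because cap and the three unit
  angles are), and the adversarially maximised second-order coefficient of `λ₃+λ₄ − 3/2` over all 192 real perturbation
  directions of the six products is `−0.0034 ↑ 0⁻` (never positive; `0` along orbit/gauge directions) — a genuinely
  stronger second-order condition than the crux's (`h₄ ≤ |μ_min|` instead of `h₄ ≤ |μ₁+μ₂+μ₃|` for the splitting of the
  triple eigenvalue `1`), and it holds.  On border strata (`estrata.py … two`, 12 restarts each) `λ₃+λ₄` tops out at
  `1.49989 (T2P⁴), 1.5000000 (D3P³), 1.49964 (D4qP²), 1.49831 (T3P³ → iso), 1.49998 (F3P³ → iso)` — never above.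
  For the provers this is the natural sharper
  target (a statement about a 2-plane in `W`, i.e. about `2×2` compressions); for this seat it says a counterexample
  to the crux must in particular beat the two-angle law, whose tight set is larger than the crux's.
* `sup (λ₂+λ₃+λ₄) = 5/2` is attained ONLY at the crux maximisers (40/40 flows of the three-smallest objective end at
  profile `(½,1,1,1)`, `cap = 7.000000000`) — an E-picture re-confirmation of `M(2,6) = 7` by an optimiser and an
  objective different from all previous ones (cycle 1–2: ALS/LM on the ratio; ideator 3: L-BFGS on `cap`).
-/


/-! ## (j) Border strata in the E-picture, and two more candidate laws (cycle 3; `num/estrata.py`, `estrata2.py`,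
`eplane.py ptk`, pure python)

BORDER STRATA CENSUS.  The closure of the product-spanned 6-planes contains the planes spanned by JETS of the
Segre variety `P³ × P³ ⊂ P(X ⊗ Y)`: curvilinear `T_m` = `{d^j/dt^j x(t)⊗y(t)}_{j<m}` (Leibniz), fat `F_m` = point +
`m−1` tangents `x_i⊗y + x⊗y_i`, in every partition of `6`; and the SYZYGY strata `D_m`: `m` points with
`Σ_{i≤m} x_i⊗y_i = 0`, their companion `v = Σ_i (x_i'⊗y_i + x_i⊗y_i')`, and `6 − m` honest points (the E-picture of
the order-one border decompositions; Bini lives in `D_5`-type).  Ascent of `cap/2 = tr(P_E Π_W)` (crux: `≤ 3.5`),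
20 restarts × 400 steps per stratum:
  `P⁶ 3.4999968 · T2P⁴ 3.4963 · T2²P² 3.4947 · T2³ 3.4081 · T3P³ 3.4885 · T3T2P 3.4737 · T3² 3.3886 · T4P² 3.4900 ·
   T4T2 3.3896 · T5P 3.4542 · T6 3.2961 · F3P³ 3.49999999909 · F3T2P 3.4953 · F3² 3.2041 · F3T3 3.3198 · F4P² 3.000 ·
   F4T2 3.000 · F5P 2.500 · F6 2.000`;  EXACT syzygy strata (`estrata.py D…`; for three rank-one matrices
  `Σ x_i⊗y_i = 0` forces a shared factor, so `D3 = span{x⊗y₁, x⊗y₂, a⊗y₁ + b⊗y₂ + x⊗y'}`, `D3t` its transpose,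
  `D4x` = shared `x` with four `y`'s, `D5x = x⊗Y + Σ a_i⊗y_i`, `D4q` = four points on a common `P¹×P¹`):
  `D3P³ 3.4999999999 · D3tP³ 3.5000000000 · D3T2P 3.4973 · D3² 3.2045 · D4xP² 3.000 · D4qP² 3.4982 · D5xP 2.500 ·
   D3F3 3.1855 · D4xT2 3.000 · D4qT2 3.3528` (the penalty version `estrata2.py`, inexact syzygies, once showed a
  "formal" `3.5065` at residual `3·10⁻⁴` with honest value `2.87` — an artefact the exact parametrisation removes).
  NOTHING above `3.5`; the curvilinear strata approach `3.5` only by un-degenerating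
  towards the honest maximiser profile `(½,1,1,1)`, and `F3P³` attains `3.5` exactly because the tangent space at a
  point `x⊗y` contains the honest products `x⊗y'`, `x'⊗y` (the maximiser's slice space is of that shape).  Fat points are
  expensive: `F4 ≤ 3`, `F5 ≤ 2.5`, `F6 = 2` (a 6-plane inside one tangent space `T_p` captures at most `2`).
  (Complements ideator 3's four border strata, kit j008098, and cycle 1 § (e) border-seeded tensor flows.)
THREE MORE CANDIDATE LAWS, graded.  (o) TOP-PLUS-BOTTOM LAW `λ₁ + λ₄ ≤ 3/2` (it would imply the two-angle law): FALSE —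
`sup (λ₁+λ₄) ≥ 1.6973` (`topbot_run1.txt`, 16 restarts), the flows heading to a NEW stationary family with profile
`(1, 0.70, 0.70, 0.70)` (one slice inside `E`, isotropic `≈ 0.698` on the other three; `cap ≈ 6.19`), so "a plane that
contains a slice direction has a direction at `45°`" fails; only the Ky-Fan sums of § (i) are sharp.  (i) COLUMN-PAIR LAW "some output column direction `r ∈ ℂ²` has its two outputs
`(C r)_κ` captured `≤ 3/2`", i.e. `λ_min(Tr_κ B) ≤ 3/2` (partial trace of `B` over the row index; it would imply the
two-angle law by Ky Fan): FALSE — `sup λ_min(Tr_κ B) ≥ 1.6025` (`ptk_run1.txt`, 24 restarts, profile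
`(0.486,0.739,0.981,0.999)`, `cap 6.41`); by the transpose symmetry the row-pair law fails too.  So the 2-plane
`W₂ ⊂ W` in the two-angle law `∃ W₂, tr(P_E P_{W₂}) ≤ 3/2` cannot be taken of the form `{(x rᵀ) ⊗ I}`.
(ii) ORTHONORMAL GRID FRAMES `e_s = a_{i_s} ⊗ c_{j_s}` (`A, C` orthonormal bases of `X, Y`, six cells): over real
orthogonal `A, C` and 14 cell patterns `sup λ_min(B) = 1/2` exactly (`gridframe.py`: capture form `λ_min = 1.000000`,
threshold `1`) — such frames never beat the fourth-angle threshold, which is why the isotropic witness of § (i) needs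
NON-orthogonal products (Gram `(9/10)I + (1/10)J` per block) and hence a Gram inverse in any formalisation.
-/

end Summit.MatrixMultiplication.MatrixMultiplication.Cruxes.SevenEighthsLaw.Disproof
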